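import Literature.Probability.Percolation.BondClusterCounting
import Literature.Probability.Percolation.ExplorationHoeffding
import Literature.Probability.Percolation.FiniteEnergy
import Literature.Probability.Percolation.CoveringMonotonicity
import Mathlib.Analysis.SpecialFunctions.Pow.Real
import Mathlib.Analysis.SpecialFunctions.Sqrt
import HarnessLib

/-!
# The central inequality of Cerf 2015 (§5) for BOND percolation on a locally finite graph

Topic `Literature/Probability/Percolation`. Probabilistic part of the Aizenman–Kesten–Newman /
Gandolfi–Grimmett–Russo counting for bond percolation (sequel of `BondClusterCounting.lean`),
following R. Cerf, *A lower bound on the two-arms exponent for critical percolation on the lattice*,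
Ann. Probab. 43 (2015), §3 and §5 (arXiv:1306.3105, pp. 5–6, 8–9), transposed from sites to
bonds as needed for Proposition 1 of Duminil-Copin–Kozma–Tassion 2020 (§7). For Bernoulli bond
percolation `P_p` on a countable locally finite graph `G`, finite `Λ ⊆ L`:

* §A  **`E|G| = ((1−p)/p) E|F|`** (Cerf §3: "the event {a neighbour of `x` is connected to `∂ⁱⁿΛ(n+ℓ)`}
  is independent of the status of the site `x` itself"): for an edge `e` inside `Λ`, the event
  `D_e` "an endpoint of `e` is joined to `∂ⁱⁿL` inside `L` without using `e`" is determined by the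
  other edges, `e ∈ F ↔ e open ∧ D_e`, `e ∈ G ↔ e closed ∧ D_e` (`integral_card_Gset_eq`); hence
  `E|H| = (1−p) E[Σ_{C ∈ 𝒞} h(touchIn Λ C)]` (`integral_card_Hset_eq`);
* §B  **the terminal state of the exploration** of the cluster of `x` inside `L`
  (`ClusterExploration.run` on the step graph `withinGraph G L`): the queried edges inside `Λ` are
  `touchIn Λ (clus x)`, so Cerf's statistic `h(touchIn Λ (clus x))` and `|touchIn Λ (clus x)|` are
  `statH`/`lenIn` of the run (`hstat_touchIn_clus_eq`), and the large deviation estimate Prop. 4.1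
  (`ExplorationHoeffding.lean`) applies under `P_p^G` (`real_hstat_ge_le`; transfer from the step
  graph's measure by restriction of the product measure, `real_eq_real_withinGraph`);
* §C  **the central inequality** (Cerf Lemma 5.1, expectation form):
  `E[Σ_{C ∈ 𝒞} h(touchIn Λ C)] ≤ t √(2|E(Λ)|) E√|𝒞| + (2|E(Λ)|/(p(1−p))) · 2|Λ||E(Λ)| e^{−2p²(1−p)²t²}`
  for every `t ≥ 0` (Cerf: `t = ln n`), via the event `ℰ = {∀ C ∈ 𝒞, |h(touchIn Λ C)| ≤ t |touchIn Λ C|^{1/2}}`,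
  Cauchy–Schwarz and `Σ_C |touchIn Λ C| ≤ 2|E(Λ)|` (`integral_sum_hstat_le`).

The lattice specialisation (translation invariance, the two-arms edges, `|𝒞| ≤ |∂ⁱⁿΛ(n+ℓ)|`,
Proposition 5.2 with a constant uniform in `p ∈ [δ, 1−δ]`) is in the sequel.

## References

* R. Cerf, Ann. Probab. 43 (2015), §3 (p. 5–6), Prop. 4.1 (p. 7), §5 and Lemma 5.1 (pp. 8–9)
  [Cerf2015].
* H. Duminil-Copin, G. Kozma, V. Tassion, arXiv:1902.03207, §7 [DuminilcopinKozmaTassion2020].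
-/

noncomputable section

namespace Literature.Probability.Percolation

namespace AKN

open _root_.MeasureTheory LatticeModels Finset ClusterExploration
open scoped Classical

variable {V : Type*} [DecidableEq V] {G : SimpleGraph V} [G.LocallyFinite]

/-! ## §A. `E|G| = ((1−p)/p) E|F|` -/

section Independence

omit [DecidableEq V] [G.LocallyFinite] in
/-- **Last use of an edge.** In the open step graph, if `a` is joined to `w`, then in the open step
graph of the configuration with the edge `s(u,v)` closed, either `a` is still joined to `w`, or `u`
or `v` is (after the last traversal of `s(u,v)` the walk no longer uses it). [folklore] -/
theorem reachable_diff_singleton_or {K : SimpleGraph V} {ω : BondConfig V} {u v a w : V}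
    (h : (openGraph ω ⊓ K).Reachable a w) :
    (openGraph (ω \ {s(u, v)}) ⊓ K).Reachable a w ∨ (openGraph (ω \ {s(u, v)}) ⊓ K).Reachable u w ∨
      (openGraph (ω \ {s(u, v)}) ⊓ K).Reachable v w := by
  rw [SimpleGraph.reachable_iff_reflTransGen] at h
  induction h using Relation.ReflTransGen.head_induction_on with
  | refl => exact Or.inl (SimpleGraph.Reachable.refl _)
  | @head b c hbc _ ih =>
    rcases ih with ih | ih | ih
    · by_cases he : s(b, c) = s(u, v)
      · -- the step is the edge itself: `c ∈ {u, v}`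
        rcases Sym2.eq_iff.1 he with ⟨-, rfl⟩ | ⟨-, rfl⟩
        · exact Or.inr (Or.inr ih)
        · exact Or.inr (Or.inl ih)
      · left
        refine SimpleGraph.Reachable.trans (SimpleGraph.Adj.reachable ?_) ih
        rw [SimpleGraph.inf_adj, openGraph_adj]
        rw [SimpleGraph.inf_adj, openGraph_adj] at hbc
        exact ⟨⟨⟨hbc.1.1, he⟩, hbc.1.2⟩, hbc.2⟩
    · exact Or.inr (Or.inl ih)
    · exact Or.inr (Or.inr ih)

/-- **`Reaches` without the edge**: for an open edge `s(u,v)`, an endpoint reaches `∂ⁱⁿL` iff an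
endpoint reaches `∂ⁱⁿL` in the configuration with the edge closed. [cite: Cerf2015, §3] -/
theorem reaches_or_iff_diff (L : Finset V) (ω : BondConfig V) (u v : V) :
    (Reaches G L ω u ∨ Reaches G L ω v) ↔
      (Reaches G L (ω \ {s(u, v)}) u ∨ Reaches G L (ω \ {s(u, v)}) v) := by
  constructor
  · rintro (⟨w, hw, hwu⟩ | ⟨w, hw, hwv⟩)
    · rw [mem_openClusterIn_iff] at hwu
      rcases reachable_diff_singleton_or (u := u) (v := v) hwu with h | h | h
      · exact Or.inl ⟨w, hw, mem_openClusterIn_iff.2 h⟩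
      · exact Or.inl ⟨w, hw, mem_openClusterIn_iff.2 h⟩
      · exact Or.inr ⟨w, hw, mem_openClusterIn_iff.2 h⟩
    · rw [mem_openClusterIn_iff] at hwv
      rcases reachable_diff_singleton_or (u := u) (v := v) hwv with h | h | h
      · exact Or.inr ⟨w, hw, mem_openClusterIn_iff.2 h⟩
      · exact Or.inl ⟨w, hw, mem_openClusterIn_iff.2 h⟩
      · exact Or.inr ⟨w, hw, mem_openClusterIn_iff.2 h⟩
  · rintro (⟨w, hw, hwu⟩ | ⟨w, hw, hwv⟩)
    · exact Or.inl ⟨w, hw, openClusterIn_mono_config _ (fun _ h => h.1) _ hwu⟩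
    · exact Or.inr ⟨w, hw, openClusterIn_mono_config _ (fun _ h => h.1) _ hwv⟩

/-- The event "the cluster of `x` inside `L` reaches `∂ⁱⁿL`", as a union of constrained connection
events; it is measurable and determined by the steps inside `L`. [cite: Cerf2015, §2] -/
theorem setOf_reaches_eq (L : Finset V) (x : V) :
    {ω : BondConfig V | Reaches G L ω x} = ⋃ w ∈ innerBoundary G L, openConnVia (withinGraph G ↑L) x w := by
  ext ω; simp [Reaches, openConnVia]

variable [Countable V]

/-- Measurability of the reaching event. [folklore] -/
theorem measurableSet_reaches (L : Finset V) (x : V) : MeasurableSet {ω : BondConfig V | Reaches G L ω x} := by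
  rw [setOf_reaches_eq]
  exact MeasurableSet.biUnion (Finset.countable_toSet _) fun w _ => measurableSet_openConnVia _ _ _

omit [Countable V] in
/-- The reaching event is determined by the steps inside `L`. [folklore] -/
theorem determinedBy_reaches (L : Finset V) (x : V) :
    DeterminedBy {ω : BondConfig V | Reaches G L ω x} (withinGraph G ↑L).edgeSet := by
  rw [setOf_reaches_eq]
  have : (⋃ w ∈ innerBoundary G L, openConnVia (withinGraph G ↑L) x w) =
      ⋃ w ∈ (↑(innerBoundary G L) : Set V), openConnVia (withinGraph G ↑L) x w := by ext; simp
  rw [this]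
  exact DeterminedBy.iUnion fun w => DeterminedBy.iUnion fun _ => determinedBy_openConnVia _ _ _

omit [DecidableEq V] [G.LocallyFinite] [Countable V] in
/-- Closing one edge: the preimage of an event determined by `T` is determined by `T ∖ {e}`. [folklore] -/
theorem determinedBy_preimage_diff {A : Set (BondConfig V)} {T : Set (Sym2 V)} (hA : DeterminedBy A T)
    (e : Sym2 V) : DeterminedBy ((fun ω : BondConfig V => ω \ {e}) ⁻¹' A) (T \ {e}) := by
  rw [determinedBy_iff] at hA ⊢
  intro ω ω' h
  simp only [Set.mem_preimage]
  refine hA _ _ ?_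
  ext f
  simp only [Set.mem_inter_iff, Set.mem_sdiff, Set.mem_singleton_iff]
  have hf := Set.ext_iff.1 h f
  simp only [Set.mem_inter_iff, Set.mem_sdiff, Set.mem_singleton_iff] at hf
  constructor
  · rintro ⟨⟨h1, h2⟩, h3⟩; exact ⟨⟨(hf.1 ⟨h1, h3, h2⟩).1, h2⟩, h3⟩
  · rintro ⟨⟨h1, h2⟩, h3⟩; exact ⟨⟨(hf.2 ⟨h1, h3, h2⟩).1, h2⟩, h3⟩

omit [DecidableEq V] [G.LocallyFinite] [Countable V] in
/-- Closing one edge is a measurable map of configurations. [folklore] -/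
theorem measurable_diff_singleton (e : Sym2 V) : Measurable fun ω : BondConfig V => ω \ {e} :=
  measurable_set_iff.2 fun f => (measurable_set_mem f).and measurable_const

/-- **The event `D_e`** (Cerf §3, "a neighbour of `x` is connected to `∂ⁱⁿΛ(n+ℓ)` by an open path",
bond form: an endpoint of `e = s(u,v)` reaches `∂ⁱⁿL` inside `L` without using `e`) is measurable
and determined by the edges other than `e`. [cite: Cerf2015, §3] -/
theorem measurableSet_D (L : Finset V) (u v : V) :
    MeasurableSet {ω : BondConfig V | Reaches G L (ω \ {s(u, v)}) u ∨ Reaches G L (ω \ {s(u, v)}) v} := by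
  have : {ω : BondConfig V | Reaches G L (ω \ {s(u, v)}) u ∨ Reaches G L (ω \ {s(u, v)}) v} =
      (fun ω : BondConfig V => ω \ {s(u, v)}) ⁻¹' ({ω | Reaches G L ω u} ∪ {ω | Reaches G L ω v}) := by
    ext ω; simp
  rw [this]
  exact ((measurableSet_reaches L u).union (measurableSet_reaches L v)).preimage (measurable_diff_singleton _)

omit [Countable V] in
/-- `D_e` is determined by the edges other than `e`. [cite: Cerf2015, §3] -/
theorem determinedBy_D (L : Finset V) (u v : V) :
    DeterminedBy {ω : BondConfig V | Reaches G L (ω \ {s(u, v)}) u ∨ Reaches G L (ω \ {s(u, v)}) v}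
      ({s(u, v)}ᶜ : Set (Sym2 V)) := by
  have : {ω : BondConfig V | Reaches G L (ω \ {s(u, v)}) u ∨ Reaches G L (ω \ {s(u, v)}) v} =
      (fun ω : BondConfig V => ω \ {s(u, v)}) ⁻¹' ({ω | Reaches G L ω u} ∪ {ω | Reaches G L ω v}) := by
    ext ω; simp
  rw [this]
  have hdet : DeterminedBy ({ω : BondConfig V | Reaches G L ω u} ∪ {ω | Reaches G L ω v}) Set.univ := by
    rw [determinedBy_iff]; intro ω ω' h; simp only [Set.inter_univ] at h; rw [h]
  have h := determinedBy_preimage_diff hdet (s(u, v))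
  refine h.mono ?_
  intro f hf
  simp only [Set.mem_sdiff, Set.mem_univ, Set.mem_singleton_iff, true_and] at hf
  exact hf

omit [Countable V] in
/-- **`e ∈ F ↔ e open ∧ D_e`** for an edge `e = s(u,v)` inside `Λ`. [cite: Cerf2015, §3] -/
theorem mk_mem_Fset_iff {L Λ : Finset V} {ω : BondConfig V} {u v : V} (he : s(u, v) ∈ edgesIn G Λ) :
    s(u, v) ∈ Fset G L Λ ω ↔ s(u, v) ∈ ω ∧ (Reaches G L (ω \ {s(u, v)}) u ∨ Reaches G L (ω \ {s(u, v)}) v) := by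
  simp only [Fset, Finset.mem_filter, he, true_and, ← reaches_or_iff_diff]
  refine and_congr_right fun _ => ?_
  constructor
  · rintro ⟨w, hw, hr⟩
    rcases Sym2.mem_iff.1 hw with rfl | rfl
    · exact Or.inl hr
    · exact Or.inr hr
  · rintro (h | h)
    · exact ⟨u, Sym2.mem_mk_left _ _, h⟩
    · exact ⟨v, Sym2.mem_mk_right _ _, h⟩

omit [Countable V] in
/-- **`e ∈ G ↔ e closed ∧ D_e`** for an edge `e = s(u,v)` inside `Λ` (a closed edge is not used by any
open path). [cite: Cerf2015, §3] -/
theorem mk_mem_Gset_iff {L Λ : Finset V} {ω : BondConfig V} {u v : V} (he : s(u, v) ∈ edgesIn G Λ) :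
    s(u, v) ∈ Gset G L Λ ω ↔ s(u, v) ∉ ω ∧ (Reaches G L (ω \ {s(u, v)}) u ∨ Reaches G L (ω \ {s(u, v)}) v) := by
  simp only [Gset, Finset.mem_filter, he, true_and]
  refine and_congr_right fun hclosed => ?_
  have hω : ω \ {s(u, v)} = ω := by
    ext f; simp only [Set.mem_sdiff, Set.mem_singleton_iff, and_iff_left_iff_imp]
    rintro hf rfl; exact hclosed hf
  rw [hω]
  constructor
  · rintro ⟨w, hw, hr⟩
    rcases Sym2.mem_iff.1 hw with rfl | rfl
    · exact Or.inl hr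
    · exact Or.inr hr
  · rintro (h | h)
    · exact ⟨u, Sym2.mem_mk_left _ _, h⟩
    · exact ⟨v, Sym2.mem_mk_right _ _, h⟩

/-- **`P(e ∈ F) = p · P(D_e)` and `P(e ∈ G) = (1−p) · P(D_e)`** (independence of `D_e` from the state
of `e`). [cite: Cerf2015, §3 (P(x ∈ F | x ∈ F ∪ G) = p)] -/
theorem real_mk_mem_Fset_Gset {L Λ : Finset V} (p : unitInterval) {u v : V} (he : s(u, v) ∈ edgesIn G Λ) :
    (bondPercolation G p).real {ω | s(u, v) ∈ Fset G L Λ ω} =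
        p * (bondPercolation G p).real {ω | Reaches G L (ω \ {s(u, v)}) u ∨ Reaches G L (ω \ {s(u, v)}) v} ∧
      (bondPercolation G p).real {ω | s(u, v) ∈ Gset G L Λ ω} =
        (1 - p) * (bondPercolation G p).real {ω | Reaches G L (ω \ {s(u, v)}) u ∨ Reaches G L (ω \ {s(u, v)}) v} := by
  set D : Set (BondConfig V) := {ω | Reaches G L (ω \ {s(u, v)}) u ∨ Reaches G L (ω \ {s(u, v)}) v} with hD
  have hE : s(u, v) ∈ G.edgeSet := (mem_edgesIn_iff.1 he).1
  have hdisj : Disjoint ({s(u, v)} : Set (Sym2 V)) {s(u, v)}ᶜ := disjoint_compl_right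
  have hopen : DeterminedBy {ω : BondConfig V | s(u, v) ∈ ω} ({s(u, v)} : Set (Sym2 V)) := by
    rw [determinedBy_iff]; intro ω ω' h
    have := Set.ext_iff.1 h (s(u, v)); simp at this; simp [this]
  have hclosed : DeterminedBy {ω : BondConfig V | s(u, v) ∉ ω} ({s(u, v)} : Set (Sym2 V)) := by
    rw [determinedBy_iff]; intro ω ω' h
    have := Set.ext_iff.1 h (s(u, v)); simp at this; simp [this]
  constructor
  · have hset : {ω : BondConfig V | s(u, v) ∈ Fset G L Λ ω} = {ω | s(u, v) ∈ ω} ∩ D := by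
      ext ω; simp only [Set.mem_setOf_eq, Set.mem_inter_iff, hD]; exact mk_mem_Fset_iff he
    rw [hset, bondPercolation_real_inter_of_disjoint G p hdisj hopen (determinedBy_D L u v)
      (measurableSet_mem _) (measurableSet_D L u v), bondPercolation_cylinder G p hE]
  · have hset : {ω : BondConfig V | s(u, v) ∈ Gset G L Λ ω} = {ω | s(u, v) ∉ ω} ∩ D := by
      ext ω; simp only [Set.mem_setOf_eq, Set.mem_inter_iff, hD]; exact mk_mem_Gset_iff he
    rw [hset, bondPercolation_real_inter_of_disjoint G p hdisj hclosed (determinedBy_D L u v)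
      (measurableSet_mem _).compl (measurableSet_D L u v), DCT16.real_notMem G p hE]

/-- Measurability of `{ω | e ∈ Fset ω}`. [folklore] -/
theorem measurableSet_mem_Fset (L Λ : Finset V) {e : Sym2 V} (he : e ∈ edgesIn G Λ) :
    MeasurableSet {ω : BondConfig V | e ∈ Fset G L Λ ω} := by
  obtain ⟨u, v, rfl, -, -, -⟩ := exists_eq_of_mem_edgesIn he
  have hset : {ω : BondConfig V | s(u, v) ∈ Fset G L Λ ω} = {ω | s(u, v) ∈ ω} ∩
      {ω | Reaches G L (ω \ {s(u, v)}) u ∨ Reaches G L (ω \ {s(u, v)}) v} := by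
    ext ω; simp only [Set.mem_setOf_eq, Set.mem_inter_iff]; exact mk_mem_Fset_iff he
  rw [hset]; exact (measurableSet_mem _).inter (measurableSet_D L u v)

/-- Measurability of `{ω | e ∈ Gset ω}`. [folklore] -/
theorem measurableSet_mem_Gset (L Λ : Finset V) {e : Sym2 V} (he : e ∈ edgesIn G Λ) :
    MeasurableSet {ω : BondConfig V | e ∈ Gset G L Λ ω} := by
  obtain ⟨u, v, rfl, -, -, -⟩ := exists_eq_of_mem_edgesIn he
  have hset : {ω : BondConfig V | s(u, v) ∈ Gset G L Λ ω} = {ω | s(u, v) ∉ ω} ∩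
      {ω | Reaches G L (ω \ {s(u, v)}) u ∨ Reaches G L (ω \ {s(u, v)}) v} := by
    ext ω; simp only [Set.mem_setOf_eq, Set.mem_inter_iff]; exact mk_mem_Gset_iff he
  rw [hset]; exact (measurableSet_mem _).compl.inter (measurableSet_D L u v)

/-- **`E|G| = ((1−p)/p) E|F|`**, in the form `(1−p) E|F| = p E|G|` (Cerf 2015, §3:
"`E(|G|) = (1−p) E(|F ∪ G|)`", "`E(|F|) = p E(|F ∪ G|)`"). [cite: Cerf2015, §3] -/
theorem integral_card_Gset_eq {L Λ : Finset V} (p : unitInterval) :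
    (1 - p : ℝ) * ∫ ω, ((Fset G L Λ ω).card : ℝ) ∂(bondPercolation G p) =
      p * ∫ ω, ((Gset G L Λ ω).card : ℝ) ∂(bondPercolation G p) := by
  set μ := bondPercolation G p with hμ
  have hcard : ∀ (S : BondConfig V → Finset (Sym2 V)), (∀ ω, S ω ⊆ edgesIn G Λ) → ∀ ω, ((S ω).card : ℝ) =
      ∑ e ∈ edgesIn G Λ, ({ω | e ∈ S ω} : Set (BondConfig V)).indicator (fun _ => (1 : ℝ)) ω := by
    intro S hS ω
    have hfil : S ω = (edgesIn G Λ).filter (fun e => e ∈ S ω) := by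
      ext e; simp only [Finset.mem_filter]; exact ⟨fun h => ⟨hS ω h, h⟩, fun h => h.2⟩
    rw [hfil, Finset.card_eq_sum_ones, Finset.sum_filter]
    push_cast
    refine Finset.sum_congr rfl fun e _ => ?_
    by_cases h : e ∈ S ω
    · rw [if_pos h, Set.indicator_of_mem (by exact h)]
    · rw [if_neg h, Set.indicator_of_notMem (by exact h)]
  have hF := hcard (Fset G L Λ) (fun ω => Finset.filter_subset _ _)
  have hG := hcard (Gset G L Λ) (fun ω => Finset.filter_subset _ _)
  simp_rw [hF, hG]
  rw [integral_finsetSum _ (fun e he => (integrable_const (1 : ℝ)).indicator (measurableSet_mem_Fset L Λ he)),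
    integral_finsetSum _ (fun e he => (integrable_const (1 : ℝ)).indicator (measurableSet_mem_Gset L Λ he)),
    Finset.mul_sum, Finset.mul_sum]
  refine Finset.sum_congr rfl fun e he => ?_
  obtain ⟨u, v, rfl, -, -, -⟩ := exists_eq_of_mem_edgesIn he
  rw [integral_indicator_const _ (measurableSet_mem_Fset L Λ he),
    integral_indicator_const _ (measurableSet_mem_Gset L Λ he), smul_eq_mul, smul_eq_mul, mul_one, mul_one]
  obtain ⟨h1, h2⟩ := real_mk_mem_Fset_Gset (L := L) (Λ := Λ) p he
  rw [h1, h2]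
  ring

end Independence

/-! ## §B. The exploration of a cluster inside `L` and Proposition 4.1 under `P_p^G` -/

section Exploration

/-- The step graph inside a set is locally finite (its neighbourhoods are subsets of those of `G`).
[folklore] -/
instance instLocallyFiniteWithinGraph (R : Set V) : (withinGraph G R).LocallyFinite := fun v =>
  Fintype.ofFinset ((G.neighborFinset v).filter fun w => v ∈ R ∧ w ∈ R) (by
    intro w
    simp only [Finset.mem_filter, SimpleGraph.mem_neighborFinset, SimpleGraph.mem_neighborSet,
      withinGraph_adj])

/-- Edges of the step graph inside `L` are the edges of `G` inside `L`. [folklore] -/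
theorem mem_edgeSet_withinGraph_iff_mem_edgesIn {L : Finset V} {e : Sym2 V} :
    e ∈ (withinGraph G ↑L).edgeSet ↔ e ∈ edgesIn G L := by
  induction e using Sym2.ind with
  | _ u v =>
    rw [mem_edgeSet_withinGraph, mem_edgesIn_iff, SimpleGraph.mem_edgeSet]
    constructor
    · rintro ⟨h, hu, hv⟩
      refine ⟨h, fun x hx => ?_⟩
      rcases Sym2.mem_iff.1 hx with rfl | rfl
      · exact Finset.mem_coe.1 hu
      · exact Finset.mem_coe.1 hv
    · rintro ⟨h, hmem⟩
      exact ⟨h, Finset.mem_coe.2 (hmem u (Sym2.mem_mk_left _ _)), Finset.mem_coe.2 (hmem v (Sym2.mem_mk_right _ _))⟩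

/-- Edges of the step graph touching a finite set are edges of `G` inside `L`. [folklore] -/
theorem edgesTouching_withinGraph_subset (L K : Finset V) :
    edgesTouching (withinGraph G ↑L) K ⊆ edgesIn G L := by
  intro e he
  rw [mem_edgesTouching_iff] at he
  exact mem_edgeSet_withinGraph_iff_mem_edgesIn.1 he.1

/-- **The run only reads the steps inside `L`**: exploring `ω` or `ω ∩ E(withinGraph G L)` gives the
same states. [folklore] -/
theorem run_inter_edgeSet (L : Finset V) (ncap : ℕ) (x : V) (ω : BondConfig V) (k : ℕ) :
    run (withinGraph G ↑L) ncap x (ω ∩ (withinGraph G ↑L).edgeSet) k = run (withinGraph G ↑L) ncap x ω k := by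
  refine run_congr x k ?_
  intro eb heb
  have hI := inv_run (G := withinGraph G ↑L) (n := ncap) x ω k
  have hq : eb.1 ∈ queried (run (withinGraph G ↑L) ncap x ω k) := mem_queried_iff.2 ⟨eb.2, heb⟩
  have hE := (hI.queried_spec eb.1 hq).1
  rw [Set.mem_inter_iff, hI.answers eb heb]
  simp [hE, ← hI.answers eb heb]

/-- The terminal time used below: `N = |E(L)|` steps, vertex cap `N + 2`; the cluster of `x ∈ L` as a
finite set and the bound on the number of edges touching it. [folklore] -/
theorem terminal_hypotheses {L : Finset V} {x : V} (hx : x ∈ L) (ω : BondConfig V) :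
    (↑(clus G L ω x) : Set V) = openCluster (ω ∩ (withinGraph G ↑L).edgeSet) x ∧
      (edgesTouching (withinGraph G ↑L) (clus G L ω x)).card ≤ (edgesIn G L).card := by
  constructor
  · ext y
    simp only [Finset.mem_coe, mem_clus]
    change y ∈ L ∧ y ∈ openClusterIn (withinGraph G ↑L) ω x ↔ y ∈ openClusterIn (withinGraph G ↑L) ω x
    exact ⟨fun h => h.2, fun h => ⟨Finset.mem_coe.1 (openClusterIn_withinGraph_subset (Finset.mem_coe.2 hx) ω h), h⟩⟩
  · exact Finset.card_le_card (edgesTouching_withinGraph_subset L _)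

/-- **The queried edges at the terminal time are the edges inside `L` touching the cluster of `x`.**
[cite: Cerf2015, §4 (the growth algorithm terminates with C̄(x) ∩ Λ(n) = O_k ∪ C_k)] -/
theorem queried_terminal_eq {L : Finset V} {x : V} (hx : x ∈ L) (ω : BondConfig V) :
    queried (run (withinGraph G ↑L) ((edgesIn G L).card + 2) x ω (edgesIn G L).card) =
      edgesTouching (withinGraph G ↑L) (clus G L ω x) := by
  obtain ⟨hK, hN⟩ := terminal_hypotheses (G := G) hx ω
  have h := queried_run_eq (G := withinGraph G ↑L) (n := (edgesIn G L).card + 2) x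
    (ω := ω ∩ (withinGraph G ↑L).edgeSet) Set.inter_subset_right hK hN le_rfl
  rwa [run_inter_edgeSet] at h

/-- The counts of the terminal state: queries of edges of `D` answered `b` are the edges of `D`
touching the cluster with state `b`. [cite: Cerf2015, §4] -/
theorem countIn_terminal_eq {L : Finset V} {x : V} (hx : x ∈ L) (ω : BondConfig V) (D : Finset (Sym2 V)) (b : Bool) :
    countIn D b (run (withinGraph G ↑L) ((edgesIn G L).card + 2) x ω (edgesIn G L).card) =
      ((edgesTouching (withinGraph G ↑L) (clus G L ω x)).filter fun e => e ∈ D ∧ (e ∈ ω ↔ b = true)).card := by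
  set σ := run (withinGraph G ↑L) ((edgesIn G L).card + 2) x ω (edgesIn G L).card with hσ
  have hI : Inv (withinGraph G ↑L) ((edgesIn G L).card + 2) x ω σ := inv_run _ _ _
  have hnd := hI.nodup
  -- the filtered history has distinct edges
  have hsub : ((σ.hist.filter fun eb => eb.1 ∈ D ∧ eb.2 = b).map Prod.fst).Sublist (σ.hist.map Prod.fst) :=
    List.filter_sublist.map Prod.fst
  have hnd' : ((σ.hist.filter fun eb => eb.1 ∈ D ∧ eb.2 = b).map Prod.fst).Nodup := hnd.sublist hsub
  unfold countIn
  rw [← List.length_map (f := Prod.fst), ← List.toFinset_card_of_nodup hnd', ← queried_terminal_eq hx ω, ← hσ]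
  congr 1
  ext e
  simp only [Finset.mem_filter, List.mem_toFinset, List.mem_map, List.mem_filter, Prod.exists,
    exists_and_right, exists_eq_right, mem_queried_iff, decide_eq_true_eq]
  constructor
  · rintro ⟨b', hmem, hD, rfl⟩
    exact ⟨⟨_, hmem⟩, hD, hI.answers _ hmem⟩
  · rintro ⟨⟨b', hmem⟩, hD, hiff⟩
    have hb' : b' = b := by
      have h1 := hI.answers _ hmem
      simp only at h1
      cases b <;> cases b' <;> simp_all
    subst hb'
    exact ⟨b', hmem, hD, rfl⟩

/-- Open queries of edges of `D` at the terminal time. [cite: Cerf2015, §4] -/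
theorem countIn_terminal_true {L : Finset V} {x : V} (hx : x ∈ L) (ω : BondConfig V) (D : Finset (Sym2 V)) :
    countIn D true (run (withinGraph G ↑L) ((edgesIn G L).card + 2) x ω (edgesIn G L).card) =
      ((edgesTouching (withinGraph G ↑L) (clus G L ω x)).filter fun e => e ∈ D ∧ e ∈ ω).card := by
  rw [countIn_terminal_eq hx ω D true]
  exact congrArg Finset.card (Finset.filter_congr fun e _ => by simp)

/-- Closed queries of edges of `D` at the terminal time. [cite: Cerf2015, §4] -/
theorem countIn_terminal_false {L : Finset V} {x : V} (hx : x ∈ L) (ω : BondConfig V) (D : Finset (Sym2 V)) :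
    countIn D false (run (withinGraph G ↑L) ((edgesIn G L).card + 2) x ω (edgesIn G L).card) =
      ((edgesTouching (withinGraph G ↑L) (clus G L ω x)).filter fun e => e ∈ D ∧ e ∉ ω).card := by
  rw [countIn_terminal_eq hx ω D false]
  exact congrArg Finset.card (Finset.filter_congr fun e _ => by simp)

/-- **The terminal statistic is Cerf's `h` of `touchIn Λ (clus x)`** (`x ∈ Λ ⊆ L`), and the number of
queries inside `Λ` is `|touchIn Λ (clus x)|`. [cite: Cerf2015, §4] -/
theorem hstat_touchIn_clus_eq {L Λ : Finset V} (hΛL : Λ ⊆ L) {x : V} (hx : x ∈ Λ) (ω : BondConfig V) (p : ℝ) :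
    statH p (edgesIn G Λ) (run (withinGraph G ↑L) ((edgesIn G L).card + 2) x ω (edgesIn G L).card) =
        hstat p (touchIn G Λ (clus G L ω x)) ω ∧
      lenIn (edgesIn G Λ) (run (withinGraph G ↑L) ((edgesIn G L).card + 2) x ω (edgesIn G L).card) =
        (touchIn G Λ (clus G L ω x)).card := by
  have hxL : x ∈ L := hΛL hx
  -- `touchIn Λ C` versus `edgesTouching (withinGraph G L) C`
  have hkey : ∀ (Q : Sym2 V → Prop) [DecidablePred Q], ((edgesTouching (withinGraph G ↑L) (clus G L ω x)).filter
      fun e => e ∈ edgesIn G Λ ∧ Q e) = (touchIn G Λ (clus G L ω x)).filter Q := by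
    intro Q _
    ext e
    simp only [Finset.mem_filter, touchIn, mem_edgesTouching_iff, mem_edgeSet_withinGraph_iff_mem_edgesIn]
    constructor
    · rintro ⟨⟨-, y, hy, hye⟩, heΛ, hQ⟩
      exact ⟨⟨heΛ, y, hy, hye⟩, hQ⟩
    · rintro ⟨⟨heΛ, y, hy, hye⟩, hQ⟩
      refine ⟨⟨?_, y, hy, hye⟩, heΛ, hQ⟩
      rw [mem_edgesIn_iff] at heΛ ⊢
      exact ⟨heΛ.1, fun z hz => hΛL (heΛ.2 z hz)⟩
  have hkeyo : ((edgesTouching (withinGraph G ↑L) (clus G L ω x)).filter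
      fun e => e ∈ edgesIn G Λ ∧ e ∈ ω) = (touchIn G Λ (clus G L ω x)).filter fun e => e ∈ ω := by
    rw [hkey (fun e => e ∈ ω)]
  have hkeyc : ((edgesTouching (withinGraph G ↑L) (clus G L ω x)).filter
      fun e => e ∈ edgesIn G Λ ∧ e ∉ ω) = (touchIn G Λ (clus G L ω x)).filter fun e => e ∉ ω := by
    rw [hkey (fun e => e ∉ ω)]
  have ht := countIn_terminal_true (G := G) hxL ω (edgesIn G Λ)
  have hf := countIn_terminal_false (G := G) hxL ω (edgesIn G Λ)
  rw [hkeyo] at ht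
  rw [hkeyc] at hf
  constructor
  · simp only [statH, hstat, ht, hf]
  · simp only [lenIn, ht, hf]
    rw [← Finset.card_union_of_disjoint (Finset.disjoint_filter_filter_not _ _ _), Finset.filter_union_filter_not_eq]

end Exploration

/-! ## §C. Proposition 4.1 under `P_p^G`, the event `ℰ`, and the central inequality -/

section Central

variable [Countable V]

omit [DecidableEq V] [G.LocallyFinite] [Countable V] in
/-- **Restriction of `P_p^G` to the steps inside `L` is `P_p` of the step graph**: an event determined
by the steps inside `L` has the same probability under both. [folklore] -/
theorem real_eq_real_withinGraph (L : Finset V) (p : unitInterval) {A : Set (BondConfig V)}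
    (hA : DeterminedBy A (withinGraph G ↑L).edgeSet) (hAm : MeasurableSet A) :
    (bondPercolation G p).real A = (bondPercolation (withinGraph G ↑L) p).real A := by
  set W := withinGraph G ↑L with hW
  have hWG : W.edgeSet ⊆ G.edgeSet := SimpleGraph.edgeSet_mono (withinGraph_le G ↑L)
  have hmap : (bondPercolation G p).map (fun c : Set (Sym2 V) => c ∩ W.edgeSet) = bondPercolation W p := by
    rw [← sitePercolation_map_inter_edgeSet G p, ← sitePercolation_map_inter_edgeSet W p,
      Measure.map_map (measurable_inter_edgeSet W) (measurable_inter_edgeSet G)]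
    congr 1
    funext c
    change c ∩ G.edgeSet ∩ W.edgeSet = c ∩ W.edgeSet
    rw [Set.inter_assoc, Set.inter_eq_right.2 hWG]
  have hpre : (fun c : Set (Sym2 V) => c ∩ W.edgeSet) ⁻¹' A = A := by
    ext ω
    simp only [Set.mem_preimage]
    exact (determinedBy_iff _ _).1 hA _ _ (by rw [Set.inter_assoc, Set.inter_self])
  rw [← hmap, measureReal_def, measureReal_def, Measure.map_apply (measurable_inter_edgeSet W) hAm, hpre]

omit [Countable V] in
/-- Events defined through a run of the exploration inside `L` are determined by the steps inside `L`.
[folklore] -/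
theorem determinedBy_setOf_run (L : Finset V) (ncap : ℕ) (x : V) (k : ℕ) (Φ : State V → Prop) :
    DeterminedBy {ω : BondConfig V | Φ (run (withinGraph G ↑L) ncap x ω k)} (withinGraph G ↑L).edgeSet := by
  have : {ω : BondConfig V | Φ (run (withinGraph G ↑L) ncap x ω k)} =
      (fun ω : BondConfig V => ω ∩ (withinGraph G ↑L).edgeSet) ⁻¹'
        {ω | Φ (run (withinGraph G ↑L) ncap x ω k)} := by
    ext ω; simp only [Set.mem_setOf_eq, Set.mem_preimage, run_inter_edgeSet]
  rw [this]
  exact determinedBy_preimage_inter _ _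

omit [Countable V] in
/-- **Cerf 2015, Proposition 4.1, bond version, under `P_p^G`**: for `x ∈ Λ ⊆ L`, `t ≥ 0`, `k ≥ 1`,
`P_p( |h(touchIn Λ (clus x))| ≥ t, |touchIn Λ (clus x)| = k ) ≤ 2 exp(−2p²(1−p)² t²/k)`.
[cite: Cerf2015, Prop 4.1] -/
theorem real_hstat_ge_le {L Λ : Finset V} (hΛL : Λ ⊆ L) {x : V} (hx : x ∈ Λ) (p : unitInterval)
    (hp0 : 0 < (p : ℝ)) (hp1 : (p : ℝ) < 1) {t : ℝ} (ht : 0 ≤ t) {k : ℕ} (hk : 1 ≤ k) :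
    (bondPercolation G p).real {ω | t ≤ |hstat p (touchIn G Λ (clus G L ω x)) ω| ∧
        (touchIn G Λ (clus G L ω x)).card = k} ≤
      2 * Real.exp (-2 * (p : ℝ) ^ 2 * (1 - p) ^ 2 * t ^ 2 / k) := by
  have hset : {ω : BondConfig V | t ≤ |hstat p (touchIn G Λ (clus G L ω x)) ω| ∧ (touchIn G Λ (clus G L ω x)).card = k} =
      {ω | t ≤ |statH p (edgesIn G Λ) (run (withinGraph G ↑L) ((edgesIn G L).card + 2) x ω (edgesIn G L).card)| ∧
        lenIn (edgesIn G Λ) (run (withinGraph G ↑L) ((edgesIn G L).card + 2) x ω (edgesIn G L).card) = k} := by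
    ext ω
    obtain ⟨h1, h2⟩ := hstat_touchIn_clus_eq (G := G) hΛL hx ω (p : ℝ)
    simp only [Set.mem_setOf_eq, h1, h2]
  rw [hset, real_eq_real_withinGraph L p (determinedBy_setOf_run L _ x _ (fun σ => t ≤ |statH p (edgesIn G Λ) σ| ∧ lenIn (edgesIn G Λ) σ = k))
    (measurableSet_setOf_run (G := withinGraph G ↑L) (n := (edgesIn G L).card + 2) x (edgesIn G L).card
      (fun σ => t ≤ |statH p (edgesIn G Λ) σ| ∧ lenIn (edgesIn G Λ) σ = k))]
  exact real_abs_statH_ge_le (G := withinGraph G ↑L) p hp0 hp1 (edgesIn G Λ) x _ ht hk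

omit [DecidableEq V] [Countable V] in
/-- Cerf's statistic of the empty set vanishes; more generally `|h(A)| ≤ |A|/(p(1−p))` (Cerf 2015, §5:
"`|h(C̄ ∩ Λ(n))| ≤ (1/(p(1−p))) |C̄ ∩ Λ(n)|`"). [cite: Cerf2015, §5] -/
theorem abs_hstat_le (p : unitInterval) (hp0 : 0 < (p : ℝ)) (hp1 : (p : ℝ) < 1) (A : Finset (Sym2 V)) (ω : BondConfig V) :
    |hstat p A ω| ≤ A.card / ((p : ℝ) * (1 - p)) := by
  have h1p : 0 < 1 - (p : ℝ) := by linarith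
  have hsum : (((A.filter fun e => e ∉ ω).card : ℝ)) + ((A.filter fun e => e ∈ ω).card : ℝ) = A.card := by
    have := Finset.card_filter_add_card_filter_not (s := A) (fun e => e ∉ ω)
    have h' : (A.filter fun e => ¬ e ∉ ω) = A.filter fun e => e ∈ ω := Finset.filter_congr fun e _ => by simp
    rw [h'] at this
    exact_mod_cast this
  have hc0 : (0 : ℝ) ≤ (A.filter fun e => e ∉ ω).card := Nat.cast_nonneg _
  have ho0 : (0 : ℝ) ≤ (A.filter fun e => e ∈ ω).card := Nat.cast_nonneg _
  set c : ℝ := ((A.filter fun e => e ∉ ω).card : ℝ) with hc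
  set o : ℝ := ((A.filter fun e => e ∈ ω).card : ℝ) with ho
  have hoA : o ≤ A.card := by linarith
  have hcA : c ≤ A.card := by linarith
  rw [hstat, abs_le]
  constructor
  · -- `-|A|/(p(1-p)) ≤ c/(1-p) - o/p`
    have h1 : o / p ≤ A.card / ((p : ℝ) * (1 - p)) := by
      rw [div_le_div_iff₀ hp0 (mul_pos hp0 h1p)]
      have e1 : o * ((p : ℝ) * (1 - p)) ≤ o * p :=
        mul_le_mul_of_nonneg_left (mul_le_of_le_one_right hp0.le (by linarith)) ho0
      have e2 : o * (p : ℝ) ≤ A.card * p := mul_le_mul_of_nonneg_right hoA hp0.le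
      linarith
    have h2 : 0 ≤ c / (1 - p) := by positivity
    change -(↑(A.card) / ((p : ℝ) * (1 - p))) ≤ c / (1 - p) - o / p
    linarith
  · have h1 : c / (1 - p) ≤ A.card / ((p : ℝ) * (1 - p)) := by
      rw [div_le_div_iff₀ h1p (mul_pos hp0 h1p)]
      have e1 : c * ((p : ℝ) * (1 - p)) ≤ c * (1 - p) :=
        mul_le_mul_of_nonneg_left (mul_le_of_le_one_left h1p.le p.2.2) hc0
      have e2 : c * (1 - (p : ℝ)) ≤ A.card * (1 - p) := mul_le_mul_of_nonneg_right hcA h1p.le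
      linarith
    have h2 : 0 ≤ o / p := by positivity
    change c / (1 - p) - o / p ≤ ↑(A.card) / ((p : ℝ) * (1 - p))
    linarith

omit [Countable V] in
/-- **The bad event has small probability** (Cerf 2015, §5, bound on `P(ℰᶜ)`): the probability that
for some `x ∈ Λ` the cluster statistic violates `|h(touchIn Λ (clus x))| ≤ t |touchIn Λ (clus x)|^{1/2}`
is at most `2 |Λ| |E(Λ)| exp(−2p²(1−p)² t²)`. [cite: Cerf2015, §5] -/
theorem real_exists_bad_le {L Λ : Finset V} (hΛL : Λ ⊆ L) (p : unitInterval)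
    (hp0 : 0 < (p : ℝ)) (hp1 : (p : ℝ) < 1) {t : ℝ} (ht : 0 ≤ t) :
    (bondPercolation G p).real {ω | ∃ x ∈ Λ,
        t * Real.sqrt ((touchIn G Λ (clus G L ω x)).card) < |hstat p (touchIn G Λ (clus G L ω x)) ω|} ≤
      2 * Λ.card * (edgesIn G Λ).card * Real.exp (-2 * (p : ℝ) ^ 2 * (1 - p) ^ 2 * t ^ 2) := by
  set μ := bondPercolation G p with hμ
  set M := (edgesIn G Λ).card with hM
  have hsub : {ω : BondConfig V | ∃ x ∈ Λ,
      t * Real.sqrt ((touchIn G Λ (clus G L ω x)).card) < |hstat p (touchIn G Λ (clus G L ω x)) ω|} ⊆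
      ⋃ x ∈ Λ, ⋃ k ∈ Finset.Icc 1 M, {ω | t * Real.sqrt k ≤ |hstat p (touchIn G Λ (clus G L ω x)) ω| ∧
        (touchIn G Λ (clus G L ω x)).card = k} := by
    intro ω hω
    obtain ⟨x, hx, hlt⟩ := hω
    simp only [Set.mem_iUnion, Set.mem_setOf_eq, exists_prop]
    set k := (touchIn G Λ (clus G L ω x)).card with hk
    refine ⟨x, hx, k, Finset.mem_Icc.2 ⟨?_, ?_⟩, hlt.le, rfl⟩
    · by_contra h0
      have hk0 : k = 0 := by omega
      have hempty : touchIn G Λ (clus G L ω x) = ∅ := Finset.card_eq_zero.1 (hk ▸ hk0)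
      have : hstat p (touchIn G Λ (clus G L ω x)) ω = 0 := by rw [hempty]; simp [hstat]
      rw [this, abs_zero] at hlt
      have : 0 ≤ t * Real.sqrt k := by positivity
      linarith
    · exact Finset.card_le_card (Finset.filter_subset _ _)
  calc μ.real _ ≤ μ.real (⋃ x ∈ Λ, ⋃ k ∈ Finset.Icc 1 M, {ω | t * Real.sqrt k ≤ |hstat p (touchIn G Λ (clus G L ω x)) ω| ∧
        (touchIn G Λ (clus G L ω x)).card = k}) := measureReal_mono hsub (measure_ne_top _ _)
    _ ≤ ∑ x ∈ Λ, μ.real (⋃ k ∈ Finset.Icc 1 M, {ω | t * Real.sqrt k ≤ |hstat p (touchIn G Λ (clus G L ω x)) ω| ∧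
        (touchIn G Λ (clus G L ω x)).card = k}) := measureReal_biUnion_finset_le _ _
    _ ≤ ∑ x ∈ Λ, ∑ k ∈ Finset.Icc 1 M, μ.real {ω | t * Real.sqrt k ≤ |hstat p (touchIn G Λ (clus G L ω x)) ω| ∧
        (touchIn G Λ (clus G L ω x)).card = k} := Finset.sum_le_sum fun x _ => measureReal_biUnion_finset_le _ _
    _ ≤ ∑ _x ∈ Λ, ∑ _k ∈ Finset.Icc 1 M, 2 * Real.exp (-2 * (p : ℝ) ^ 2 * (1 - p) ^ 2 * t ^ 2) := by
        refine Finset.sum_le_sum fun x hx => Finset.sum_le_sum fun k hk => ?_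
        have hk1 : 1 ≤ k := (Finset.mem_Icc.1 hk).1
        have hk0 : (0 : ℝ) < k := by exact_mod_cast hk1
        have h := real_hstat_ge_le (G := G) hΛL hx p hp0 hp1 (t := t * Real.sqrt k) (by positivity) hk1
        refine h.trans (le_of_eq ?_)
        congr 1
        congr 1
        rw [mul_pow, Real.sq_sqrt hk0.le]
        field_simp
    _ = 2 * Λ.card * M * Real.exp (-2 * (p : ℝ) ^ 2 * (1 - p) ^ 2 * t ^ 2) := by
        simp only [Finset.sum_const, Nat.card_Icc, Nat.add_sub_cancel, nsmul_eq_mul]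
        ring

omit [Countable V] in
/-- **The sum of the statistics over `𝒞`, pointwise** (Cerf 2015, §5): always
`Σ_{C ∈ 𝒞} h(touchIn Λ C) ≤ 2|E(Λ)|/(p(1−p))`; and if no `x ∈ Λ` is bad,
`Σ_{C ∈ 𝒞} h(touchIn Λ C) ≤ t √|∂ⁱⁿL| √(2|E(Λ)|)` (Cauchy–Schwarz, `Σ_C |touchIn Λ C| ≤ 2|E(Λ)|`,
`|𝒞| ≤ |∂ⁱⁿL|`). [cite: Cerf2015, §5] -/
theorem sum_hstat_le {L Λ : Finset V} (hΛL : Λ ⊆ L) (p : unitInterval) (hp0 : 0 < (p : ℝ)) (hp1 : (p : ℝ) < 1)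
    {t : ℝ} (ht : 0 ≤ t) (ω : BondConfig V) :
    ∑ C ∈ bigClusters G L Λ ω, hstat p (touchIn G Λ C) ω ≤
      t * Real.sqrt ((innerBoundary G L).card) * Real.sqrt (2 * (edgesIn G Λ).card) +
        (if ∃ x ∈ Λ, t * Real.sqrt ((touchIn G Λ (clus G L ω x)).card) < |hstat p (touchIn G Λ (clus G L ω x)) ω|
          then 2 * (edgesIn G Λ).card / ((p : ℝ) * (1 - p)) else 0) := by
  have h1p : 0 < 1 - (p : ℝ) := by linarith
  have hsumcard : (∑ C ∈ bigClusters G L Λ ω, ((touchIn G Λ C).card : ℝ)) ≤ 2 * (edgesIn G Λ).card := by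
    exact_mod_cast sum_card_touchIn_le (G := G) hΛL ω
  have hA : 0 ≤ t * Real.sqrt ((innerBoundary G L).card) * Real.sqrt (2 * (edgesIn G Λ).card) := by positivity
  by_cases hbad : ∃ x ∈ Λ, t * Real.sqrt ((touchIn G Λ (clus G L ω x)).card) < |hstat p (touchIn G Λ (clus G L ω x)) ω|
  · rw [if_pos hbad]
    calc ∑ C ∈ bigClusters G L Λ ω, hstat p (touchIn G Λ C) ω
        ≤ ∑ C ∈ bigClusters G L Λ ω, ((touchIn G Λ C).card : ℝ) / ((p : ℝ) * (1 - p)) :=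
          Finset.sum_le_sum fun C _ => (le_abs_self _).trans (abs_hstat_le p hp0 hp1 _ ω)
      _ = (∑ C ∈ bigClusters G L Λ ω, ((touchIn G Λ C).card : ℝ)) / ((p : ℝ) * (1 - p)) := by
          rw [Finset.sum_div]
      _ ≤ 2 * (edgesIn G Λ).card / ((p : ℝ) * (1 - p)) := div_le_div_of_nonneg_right hsumcard (by positivity)
      _ ≤ _ := by linarith
  · rw [if_neg hbad, add_zero]
    push Not at hbad
    -- each member of `𝒞` is `clus x` with `x ∈ Λ`, hence not bad
    have hterm : ∀ C ∈ bigClusters G L Λ ω, hstat p (touchIn G Λ C) ω ≤ t * Real.sqrt ((touchIn G Λ C).card) := by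
      intro C hC
      obtain ⟨x, hx, -, rfl⟩ := mem_bigClusters_iff.1 hC
      exact (le_abs_self _).trans (hbad x hx)
    calc ∑ C ∈ bigClusters G L Λ ω, hstat p (touchIn G Λ C) ω
        ≤ ∑ C ∈ bigClusters G L Λ ω, t * Real.sqrt ((touchIn G Λ C).card) := Finset.sum_le_sum hterm
      _ = t * ∑ C ∈ bigClusters G L Λ ω, Real.sqrt 1 * Real.sqrt ((touchIn G Λ C).card) := by
          rw [Finset.mul_sum]; simp
      _ ≤ t * (Real.sqrt (∑ _C ∈ bigClusters G L Λ ω, (1 : ℝ)) *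
            Real.sqrt (∑ C ∈ bigClusters G L Λ ω, ((touchIn G Λ C).card : ℝ))) :=
          mul_le_mul_of_nonneg_left (Real.sum_sqrt_mul_sqrt_le _ (fun _ => zero_le_one) (fun _ => Nat.cast_nonneg _)) ht
      _ ≤ t * (Real.sqrt ((innerBoundary G L).card) * Real.sqrt (2 * (edgesIn G Λ).card)) := by
          refine mul_le_mul_of_nonneg_left (mul_le_mul (Real.sqrt_le_sqrt ?_) (Real.sqrt_le_sqrt hsumcard)
            (Real.sqrt_nonneg _) (Real.sqrt_nonneg _)) ht
          simp only [Finset.sum_const, nsmul_eq_mul, mul_one]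
          exact_mod_cast card_bigClusters_le (G := G) L Λ ω
      _ = _ := by ring

omit [Countable V] in
/-- A configuration-dependent sub-finset of a fixed finite edge set has cardinality the sum of the
indicators of membership. [folklore] -/
theorem card_eq_sum_indicator {E : Finset (Sym2 V)} (S : BondConfig V → Finset (Sym2 V)) (hS : ∀ ω, S ω ⊆ E)
    (ω : BondConfig V) :
    ((S ω).card : ℝ) = ∑ e ∈ E, ({ω | e ∈ S ω} : Set (BondConfig V)).indicator (fun _ => (1 : ℝ)) ω := by
  have hfil : S ω = E.filter (fun e => e ∈ S ω) := by
    ext e; simp only [Finset.mem_filter]; exact ⟨fun h => ⟨hS ω h, h⟩, fun h => h.2⟩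
  rw [hfil, Finset.card_eq_sum_ones, Finset.sum_filter]
  push_cast
  refine Finset.sum_congr rfl fun e _ => ?_
  by_cases h : e ∈ S ω
  · rw [if_pos h, Set.indicator_of_mem (by exact h)]
  · rw [if_neg h, Set.indicator_of_notMem (by exact h)]

omit [Countable V] in
/-- Integrability of such a cardinality. [folklore] -/
theorem integrable_card {E : Finset (Sym2 V)} (S : BondConfig V → Finset (Sym2 V)) (hS : ∀ ω, S ω ⊆ E)
    (hm : ∀ e ∈ E, MeasurableSet {ω : BondConfig V | e ∈ S ω}) (μ : Measure (BondConfig V)) [IsProbabilityMeasure μ] :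
    Integrable (fun ω => ((S ω).card : ℝ)) μ := by
  have h : (fun ω => ((S ω).card : ℝ)) = fun ω => ∑ e ∈ E, ({ω | e ∈ S ω} : Set (BondConfig V)).indicator (fun _ => (1 : ℝ)) ω :=
    funext (card_eq_sum_indicator S hS)
  rw [h]
  exact integrable_finsetSum _ fun e he => (integrable_const (1 : ℝ)).indicator (hm e he)

/-- Measurability of `{ω | e ∈ Hset ω}`. [folklore] -/
theorem measurableSet_mem_Hset (L Λ : Finset V) {e : Sym2 V} (he : e ∈ edgesIn G Λ) :
    MeasurableSet {ω : BondConfig V | e ∈ Hset G L Λ ω} := by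
  obtain ⟨u, v, rfl, -, -, -⟩ := exists_eq_of_mem_edgesIn he
  have hset : {ω : BondConfig V | s(u, v) ∈ Hset G L Λ ω} =
      {ω | Reaches G L ω u} ∩ {ω | Reaches G L ω v} ∩ (openConnVia (withinGraph G ↑L) u v)ᶜ := by
    ext ω
    simp only [Set.mem_setOf_eq, Set.mem_inter_iff, Set.mem_compl_iff, openConnVia, mk_mem_Hset_iff he]
    tauto
  rw [hset]
  exact ((measurableSet_reaches L u).inter (measurableSet_reaches L v)).inter (measurableSet_openConnVia _ _ _).compl

omit [Countable V] in
/-- Measurability of the bad event. [folklore] -/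
theorem measurableSet_bad {L Λ : Finset V} (hΛL : Λ ⊆ L) (p : unitInterval) (t : ℝ) :
    MeasurableSet {ω : BondConfig V | ∃ x ∈ Λ,
      t * Real.sqrt ((touchIn G Λ (clus G L ω x)).card) < |hstat p (touchIn G Λ (clus G L ω x)) ω|} := by
  have hset : {ω : BondConfig V | ∃ x ∈ Λ,
      t * Real.sqrt ((touchIn G Λ (clus G L ω x)).card) < |hstat p (touchIn G Λ (clus G L ω x)) ω|} =
      ⋃ x ∈ Λ, {ω | t * Real.sqrt (lenIn (edgesIn G Λ) (run (withinGraph G ↑L) ((edgesIn G L).card + 2) x ω (edgesIn G L).card)) <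
        |statH p (edgesIn G Λ) (run (withinGraph G ↑L) ((edgesIn G L).card + 2) x ω (edgesIn G L).card)|} := by
    ext ω
    simp only [Set.mem_setOf_eq, Set.mem_iUnion, exists_prop]
    constructor
    · rintro ⟨x, hx, h⟩
      obtain ⟨h1, h2⟩ := hstat_touchIn_clus_eq (G := G) hΛL hx ω (p : ℝ)
      exact ⟨x, hx, by rw [h1, h2]; exact h⟩
    · rintro ⟨x, hx, h⟩
      obtain ⟨h1, h2⟩ := hstat_touchIn_clus_eq (G := G) hΛL hx ω (p : ℝ)
      exact ⟨x, hx, by rw [← h1, ← h2]; exact h⟩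
  rw [hset]
  exact MeasurableSet.biUnion (Finset.countable_toSet _) fun x _ =>
    measurableSet_setOf_run (G := withinGraph G ↑L) (n := (edgesIn G L).card + 2) x (edgesIn G L).card
      (fun σ => t * Real.sqrt (lenIn (edgesIn G Λ) σ) < |statH p (edgesIn G Λ) σ|)

/-- **The central inequality (Cerf 2015, §5 / Lemma 5.1), bond version, expectation-of-`|H|` form.**
For `Λ ⊆ L` finite, `0 < p < 1` and `t ≥ 0`:
`E_p|H| ≤ (1−p) t √|∂ⁱⁿL| √(2|E(Λ)|) + (2|E(Λ)|/p) · 2|Λ||E(Λ)| exp(−2p²(1−p)²t²)`,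
where `H` is the set of edges inside `Λ` whose endpoints lie in two distinct clusters (inside `L`)
both reaching `∂ⁱⁿL` (Cerf: `E|H| ≤ 2d (ln n) √|Λ(n)| E√|𝒞| + (4d/(p(1−p))) |Λ(n)|³ e^{−2(ln n)²p²(1−p)²}`
with `|𝒞| ≤ |∂ⁱⁿΛ(n+ℓ)|`). [cite: Cerf2015, Lemma 5.1] -/
theorem integral_card_Hset_le {L Λ : Finset V} (hΛL : Λ ⊆ L) (p : unitInterval) (hp0 : 0 < (p : ℝ)) (hp1 : (p : ℝ) < 1)
    {t : ℝ} (ht : 0 ≤ t) :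
    ∫ ω, ((Hset G L Λ ω).card : ℝ) ∂(bondPercolation G p) ≤
      (1 - p) * (t * Real.sqrt ((innerBoundary G L).card) * Real.sqrt (2 * (edgesIn G Λ).card)) +
        2 * (edgesIn G Λ).card / p *
          (2 * Λ.card * (edgesIn G Λ).card * Real.exp (-2 * (p : ℝ) ^ 2 * (1 - p) ^ 2 * t ^ 2)) := by
  set μ := bondPercolation G p with hμ
  have h1p : 0 < 1 - (p : ℝ) := by linarith
  obtain ⟨A, hA⟩ : ∃ A : ℝ, A = t * Real.sqrt ((innerBoundary G L).card) * Real.sqrt (2 * (edgesIn G Λ).card) := ⟨_, rfl⟩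
  obtain ⟨B, hB⟩ : ∃ B : ℝ, B = 2 * (edgesIn G Λ).card / ((p : ℝ) * (1 - p)) := ⟨_, rfl⟩
  obtain ⟨bad, hbad⟩ : ∃ bad : Set (BondConfig V), bad = {ω | ∃ x ∈ Λ,
    t * Real.sqrt ((touchIn G Λ (clus G L ω x)).card) < |hstat p (touchIn G Λ (clus G L ω x)) ω|} := ⟨_, rfl⟩
  have hbadm : MeasurableSet bad := by rw [hbad]; exact measurableSet_bad (G := G) hΛL p t
  rw [← hA]
  -- integrability of the three cardinalities
  have hFi : Integrable (fun ω => ((Fset G L Λ ω).card : ℝ)) μ :=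
    integrable_card (Fset G L Λ) (fun ω => Finset.filter_subset _ _) (fun e he => measurableSet_mem_Fset L Λ he) μ
  have hGi : Integrable (fun ω => ((Gset G L Λ ω).card : ℝ)) μ :=
    integrable_card (Gset G L Λ) (fun ω => Finset.filter_subset _ _) (fun e he => measurableSet_mem_Gset L Λ he) μ
  have hHi : Integrable (fun ω => ((Hset G L Λ ω).card : ℝ)) μ :=
    integrable_card (Hset G L Λ) (fun ω => Finset.filter_subset _ _) (fun e he => measurableSet_mem_Hset L Λ he) μ
  -- the pointwise bound
  have hpt : ∀ ω, ((Hset G L Λ ω).card : ℝ) ≤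
      ((1 - p) * A + (1 - p) * B * bad.indicator (fun _ => (1 : ℝ)) ω) +
        (1 - p) / p * ((Fset G L Λ ω).card : ℝ) - ((Gset G L Λ ω).card : ℝ) := by
    intro ω
    rw [card_H_eq hΛL ω hp0.ne' h1p.ne']
    have hS := sum_hstat_le (G := G) hΛL p hp0 hp1 ht ω
    have hind : (if ∃ x ∈ Λ, t * Real.sqrt ((touchIn G Λ (clus G L ω x)).card) < |hstat p (touchIn G Λ (clus G L ω x)) ω|
        then 2 * ((edgesIn G Λ).card : ℝ) / ((p : ℝ) * (1 - p)) else 0) = B * bad.indicator (fun _ => (1 : ℝ)) ω := by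
      by_cases h : ∃ x ∈ Λ, t * Real.sqrt ((touchIn G Λ (clus G L ω x)).card) < |hstat p (touchIn G Λ (clus G L ω x)) ω|
      · rw [if_pos h, Set.indicator_of_mem (show ω ∈ bad by rw [hbad]; exact h), mul_one, hB]
      · rw [if_neg h, Set.indicator_of_notMem (show ω ∉ bad by rw [hbad]; exact h), mul_zero]
    rw [hind, ← hA] at hS
    have hS' : (1 - (p : ℝ)) * ∑ C ∈ bigClusters G L Λ ω, hstat p (touchIn G Λ C) ω ≤
        (1 - p) * A + (1 - p) * B * bad.indicator (fun _ => (1 : ℝ)) ω := by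
      have := mul_le_mul_of_nonneg_left hS h1p.le
      rwa [mul_add, ← mul_assoc] at this
    exact sub_le_sub_right (add_le_add_left hS' _) _
  -- integrate
  have hX : Integrable (fun ω => (1 - (p : ℝ)) * A + (1 - p) * B * bad.indicator (fun _ => (1 : ℝ)) ω) μ :=
    (integrable_const _).add (((integrable_const (1 : ℝ)).indicator hbadm).const_mul _)
  have hW : Integrable (fun ω => (1 - (p : ℝ)) / p * ((Fset G L Λ ω).card : ℝ)) μ := hFi.const_mul _
  have hXW : Integrable (fun ω => ((1 - (p : ℝ)) * A + (1 - p) * B * bad.indicator (fun _ => (1 : ℝ)) ω) +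
      (1 - (p : ℝ)) / p * ((Fset G L Λ ω).card : ℝ)) μ := hX.add hW
  have hrhs_int : Integrable (fun ω => ((1 - (p : ℝ)) * A + (1 - p) * B * bad.indicator (fun _ => (1 : ℝ)) ω) +
      (1 - (p : ℝ)) / p * ((Fset G L Λ ω).card : ℝ) - ((Gset G L Λ ω).card : ℝ)) μ := hXW.sub hGi
  have hmono := integral_mono hHi hrhs_int hpt
  refine hmono.trans ?_
  have e0 := integral_sub hXW hGi
  have e1 := integral_add hX hW
  have e2 := integral_add (μ := μ) (integrable_const ((1 - (p : ℝ)) * A))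
    (((integrable_const (1 : ℝ)).indicator hbadm).const_mul ((1 - (p : ℝ)) * B))
  rw [e0, e1, e2, integral_const ((1 - (p : ℝ)) * A),
    integral_const_mul ((1 - (p : ℝ)) * B) (fun a => bad.indicator (fun _ => (1 : ℝ)) a),
    integral_const_mul ((1 - (p : ℝ)) / p) (fun a => ((Fset G L Λ a).card : ℝ)),
    integral_indicator_const _ hbadm, smul_eq_mul, smul_eq_mul, mul_one, probReal_univ, one_mul]
  -- `((1-p)/p) E|F| - E|G| = 0`
  have hFG := integral_card_Gset_eq (G := G) (L := L) (Λ := Λ) p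
  have hzero : (1 - (p : ℝ)) / p * ∫ ω, ((Fset G L Λ ω).card : ℝ) ∂μ = ∫ ω, ((Gset G L Λ ω).card : ℝ) ∂μ := by
    rw [div_mul_eq_mul_div, div_eq_iff hp0.ne', hFG, mul_comm]
  rw [hzero, add_sub_cancel_right]
  -- the bad event
  have hPbad : μ.real bad ≤ 2 * Λ.card * (edgesIn G Λ).card * Real.exp (-2 * (p : ℝ) ^ 2 * (1 - p) ^ 2 * t ^ 2) := by
    rw [hbad]; exact real_exists_bad_le (G := G) hΛL p hp0 hp1 ht
  have hB' : (1 - p) * B = 2 * (edgesIn G Λ).card / p := by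
    rw [hB, mul_div_assoc', mul_comm (1 - (p : ℝ)), mul_div_mul_right _ _ h1p.ne']
  have hBnn : 0 ≤ 2 * ((edgesIn G Λ).card : ℝ) / p :=
    div_nonneg (mul_nonneg zero_le_two (Nat.cast_nonneg _)) hp0.le
  rw [hB']
  exact add_le_add_right (mul_le_mul_of_nonneg_left hPbad hBnn) _

end Central

end AKN

end Literature.Probability.Percolation

end
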